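import Summits.BirchSwinnertonDyer.BirchSwinnertonDyer.Theorems.SignedLowerHalvesSmallImageLowerHalfBothSignsRttCharRoadE1KStructure
import HarnessLib

/-!
# Route `SignedLowerHalves`, crux L `SmallImageLowerHalfBothSigns` (stmt-BirchSwinnertonDyer-23599), line `rtt_w3` v12 — glue brick T-2 (global half),
# RIGIDITY OF THE `k`-STRUCTURE ON `W[p]` (GLUE memo `Lines/rtt_w3-GLUE-g7.md` §4/§5 (ii) «twist compatibility `s_j (ũ • m) = û (s_j m)` with the `y`/`u` of
# `exists_kStructure_endomorphism_coords`» and §1(2) «GLOBAL `Γ_K`-equivariance of `s_j` on `M[π]`»): an additive endomorphism of `W[p]` which commutes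
# with ONE element acting through a non-scalar matrix of `k` is itself «multiplication by an element of `k`» (the commutant of a non-scalar `2 × 2`
# matrix `g₀` is `𝔽_p[g₀] = k`); hence it commutes with EVERY `σ` with `ρ̄(σ) ∈ kˣ` (local ⟹ global equivariance on `W[p]`), and a unital ring action
# on `W[p]` (honda's formal `𝒪_{K_v}`-module structure `b ↦ u_b`, p768331) commuting with such an element and containing one non-scalar member realises
# EVERY `z ∈ k` — in particular the LEAD's trace-zero `y` (p767784): `û = u_b` for some `b`, and `ũ := ι_v(b)` gives the twist compatibility from the
# `𝒪_v`-linearity of the coordinates `s_j` (honda's J-loc′ export).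

Width seat `bsd-line-slh-p3-w3` g18 under LEAD `cruxlead-stmt-BirchSwinnertonDyer-23599` (cell `bsd-ssimc`; `--supports stmt-BirchSwinnertonDyer-23599 --as helper`).
THEOREMS ONLY (no definition, no named fact, no instance, no `sorry`); linear algebra of `2 × 2` matrices over `𝔽_p` on an abstract additive group `V` with
coordinates `e₀ : V ≃+ (Fin 2 → 𝔽_p)` (§1), specialised to `V = W[p]` with the stub's datum `(Φ, k, e₀, he₀)` (§2). BSD / crux L / INJ_top are NOT proved here.

* `exists_forall_eq_mulVec` — every additive endomorphism of `V` has a coordinate matrix; `matrix_unique`.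
* ★ `exists_mem_forall_eq_mulVec_of_comm` — commuting with one non-scalar `g₀ ∈ k` ⟹ coordinate matrix in `k`
  (tree `DeligneSerre1974.TwoByTwo.exists_eq_smul_one_add_smul_of_commute`).
* ★ `comm_of_comm_of_mem_unitGroup` — ⟹ commutes with every endomorphism acting through `unitGroup k` (local ⟹ global equivariance).
* ★★ `forall_mem_exists_forall_eq_mulVec` — a unital ring action `u : R → (V →+ V)` (pointwise laws, the shape of honda's `exists_torsionAction_of_act`,
  p768331) commuting with `g₀` and with one non-scalar `u r₀` realises every
  `z ∈ k` as some `u r` (`Serre1972.adjoinElem_eq_of_mem_of_finrank_eq_two`: `k = 𝔽_p·1 + 𝔽_p·Z(r₀)`).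
* §2 curve forms: `exists_mem_forall_eq_mulVec_of_smul_comm`, `smul_comm_of_smul_comm`, `forall_mem_exists_torsionAction_eq`.

References: [Serre1972] §2.1–2.2 (the non-split Cartan `kˣ`, `k = 𝔽_p[g]`); [DeligneSerre1974] §2 (centralisers in `GL₂`); [SerreLocalFields1979] IV §1.
-/

set_option autoImplicit false
set_option linter.dupNamespace false -- D-0017: single-problem summit, the namespace repeats the problem name by design
noncomputable section

open scoped Classical MatrixGroups

namespace Summit.BirchSwinnertonDyer.BirchSwinnertonDyer.Theorems.SmallImageCharSignedSelmer

open Literature.NumberTheory.GaloisRepresentations Literature.NumberTheory.GaloisRepresentations.Serre1972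
  Literature.NumberTheory.EllipticCurves WeierstrassCurve Matrix

/-! ## §1 Abstract `V ≃+ 𝔽_p²` -/

section Abstract

variable {p : ℕ} [Fact p.Prime] {V : Type*} [AddCommGroup V]
  (k : Subalgebra (ZMod p) (Matrix (Fin 2) (Fin 2) (ZMod p))) (e₀ : V ≃+ (Fin 2 → ZMod p))

/-- Every additive endomorphism of `V` has a coordinate matrix in the frame `e₀` (additive = `𝔽_p`-linear). [folklore] -/
theorem exists_forall_eq_mulVec (û : V →+ V) : ∃ Z : Matrix (Fin 2) (Fin 2) (ZMod p), ∀ x : V, e₀ (û x) = Z *ᵥ e₀ x := by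
  letI : Module (ZMod p) V := AddCommGroup.zmodModule (fun x ↦ e₀.injective (by rw [map_nsmul, map_zero, ZModModule.char_nsmul_eq_zero]))
  let f : (Fin 2 → ZMod p) →ₗ[ZMod p] (Fin 2 → ZMod p) :=
    ((e₀ : V →+ (Fin 2 → ZMod p)).comp (û.comp (e₀.symm : (Fin 2 → ZMod p) →+ V))).toZModLinearMap p
  refine ⟨LinearMap.toMatrix' f, fun x ↦ ?_⟩
  rw [← Matrix.toLin'_apply, Matrix.toLin'_toMatrix']
  change e₀ (û x) = e₀ (û (e₀.symm (e₀ x)))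
  rw [e₀.symm_apply_apply]

/-- The coordinate matrix is unique. [folklore] -/
theorem matrix_unique {A B : Matrix (Fin 2) (Fin 2) (ZMod p)} (h : ∀ x : V, A *ᵥ e₀ x = B *ᵥ e₀ x) : A = B :=
  Matrix.mulVec_injective (funext fun w ↦ by rw [← e₀.apply_symm_apply w]; exact h _)

/-- ★ **Commutant rigidity**: an additive endomorphism `û` of `V` commuting with one map `φ₀` whose coordinate matrix `g₀` is a NON-SCALAR element of `k`
has its own coordinate matrix in `k` (`= a·1 + b·g₀`). [cite: Serre1972, §2.2] [cite: DeligneSerre1974, §2] -/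
theorem exists_mem_forall_eq_mulVec_of_comm {g₀ : Matrix (Fin 2) (Fin 2) (ZMod p)} (hg₀ : g₀ ∈ k) (hg₀s : ∀ c : ZMod p, g₀ ≠ c • 1)
    (φ₀ : V → V) (hφ₀ : ∀ x : V, e₀ (φ₀ x) = g₀ *ᵥ e₀ x) (û : V →+ V) (hcomm : ∀ x : V, û (φ₀ x) = φ₀ (û x)) :
    ∃ z ∈ k, ∀ x : V, e₀ (û x) = z *ᵥ e₀ x := by
  obtain ⟨Z, hZ⟩ := exists_forall_eq_mulVec e₀ û
  have hc : g₀ * Z = Z * g₀ := by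
    refine matrix_unique e₀ fun x ↦ ?_
    rw [← Matrix.mulVec_mulVec, ← Matrix.mulVec_mulVec, ← hZ, ← hφ₀, ← hφ₀, ← hZ, hcomm]
  obtain ⟨a, b, hab⟩ := DeligneSerre1974.TwoByTwo.exists_eq_smul_one_add_smul_of_commute hg₀s hc
  exact ⟨Z, hab ▸ k.add_mem (k.smul_mem k.one_mem a) (k.smul_mem hg₀ b), hZ⟩

/-- ★ **Local ⟹ global on `V`**: such a `û` commutes with EVERY map `φ` acting through a matrix of `unitGroup k` (`k` is commutative).
[cite: Serre1972, §2.2] -/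
theorem comm_of_comm_of_mem_unitGroup (hk : IsField k) {g₀ : Matrix (Fin 2) (Fin 2) (ZMod p)} (hg₀ : g₀ ∈ k) (hg₀s : ∀ c : ZMod p, g₀ ≠ c • 1)
    (φ₀ : V → V) (hφ₀ : ∀ x : V, e₀ (φ₀ x) = g₀ *ᵥ e₀ x) (û : V →+ V) (hcomm : ∀ x : V, û (φ₀ x) = φ₀ (û x))
    {g : GL (Fin 2) (ZMod p)} (hg : g ∈ unitGroup k) (φ : V → V)
    (hφ : ∀ x : V, e₀ (φ x) = ((g : GL (Fin 2) (ZMod p)) : Matrix (Fin 2) (Fin 2) (ZMod p)) *ᵥ e₀ x) (x : V) :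
    û (φ x) = φ (û x) := by
  obtain ⟨z, hz, hZ⟩ := exists_mem_forall_eq_mulVec_of_comm k e₀ hg₀ hg₀s φ₀ hφ₀ û hcomm
  apply e₀.injective
  rw [hZ, hφ, hφ, hZ, Matrix.mulVec_mulVec, Matrix.mulVec_mulVec, mul_eq_mul_of_mem_unitGroup hk hz hg]

/-- ★★ **A unital ring action realises all of `k`.** `u : R → (V →+ V)` additive, multiplicative, unital, each `u r` commuting with `φ₀` (non-scalar matrix
`g₀ ∈ k`), and ONE `u r₀` non-scalar: then every `z ∈ k` is the coordinate matrix of some `u r` (`r ↦ Z(r)` is a ring map into `k = 𝔽_p·1 ⊕ 𝔽_p·Z(r₀)`,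
`dim_{𝔽_p} k = 2`). [cite: Serre1972, §2.1–2.2] -/
theorem forall_mem_exists_forall_eq_mulVec (h2 : Module.finrank (ZMod p) k = 2)
    {g₀ : Matrix (Fin 2) (Fin 2) (ZMod p)} (hg₀ : g₀ ∈ k) (hg₀s : ∀ c : ZMod p, g₀ ≠ c • 1)
    (φ₀ : V → V) (hφ₀ : ∀ x : V, e₀ (φ₀ x) = g₀ *ᵥ e₀ x)
    {R : Type*} [Semiring R] (u : R → (V →+ V)) (hadd : ∀ (a b : R) (x : V), u (a + b) x = u a x + u b x)
    (hmul : ∀ (a b : R) (x : V), u (a * b) x = u a (u b x)) (hone : ∀ x : V, u 1 x = x)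
    (hcomm : ∀ (r : R) (x : V), u r (φ₀ x) = φ₀ (u r x))
    {r₀ : R} (hr₀ : ∀ c : ZMod p, ∃ x : V, e₀ (u r₀ x) ≠ c • e₀ x) :
    ∀ z ∈ k, ∃ r : R, ∀ x : V, e₀ (u r x) = z *ᵥ e₀ x := by
  have hZ : ∀ r : R, ∃ z ∈ k, ∀ x : V, e₀ (u r x) = z *ᵥ e₀ x := fun r ↦
    exists_mem_forall_eq_mulVec_of_comm k e₀ hg₀ hg₀s φ₀ hφ₀ (u r) (hcomm r)
  choose Z hZk hZe using hZ
  -- `Z` is additive, multiplicative, unital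
  have hZadd : ∀ a b : R, Z (a + b) = Z a + Z b := fun a b ↦ matrix_unique e₀ fun x ↦ by
    rw [← hZe, hadd, map_add, hZe, hZe, Matrix.add_mulVec]
  have hZmul : ∀ a b : R, Z (a * b) = Z a * Z b := fun a b ↦ matrix_unique e₀ fun x ↦ by
    rw [← hZe, hmul, hZe, hZe, Matrix.mulVec_mulVec]
  have hZone : Z 1 = 1 := matrix_unique e₀ fun x ↦ by rw [← hZe, hone, Matrix.one_mulVec]
  have hZns : ∀ c : ZMod p, Z r₀ ≠ c • 1 := fun c h ↦ by
    obtain ⟨x, hx⟩ := hr₀ c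
    exact hx (by rw [hZe, h, Matrix.smul_mulVec, Matrix.one_mulVec])
  let Zh : R →+ Matrix (Fin 2) (Fin 2) (ZMod p) := AddMonoidHom.mk' Z hZadd
  have hZnsmul : ∀ (n : ℕ) (r : R), Z (n • r) = n • Z r := fun n r ↦ map_nsmul Zh n r
  -- every `z ∈ k = 𝔽_p[Z r₀]`
  intro z hz
  rw [← adjoinElem_eq_of_mem_of_finrank_eq_two h2 (hZk r₀) hZns] at hz
  obtain ⟨a, b, rfl⟩ := hz
  refine ⟨a.val • 1 + b.val • r₀, fun x ↦ ?_⟩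
  rw [hZe, hZadd, hZnsmul, hZnsmul, hZone, ← Nat.cast_smul_eq_nsmul (ZMod p), ← Nat.cast_smul_eq_nsmul (ZMod p),
    ZMod.natCast_zmod_val, ZMod.natCast_zmod_val]

end Abstract

/-! ## §2 Curve forms: `V = W[p]` with the stub's small-image datum `(Φ, k, e₀, he₀)` -/

section Curve

variable {F : Type} [Field F] (W : WeierstrassCurve F) {p : ℕ} [Fact p.Prime]
  (Φ : Multiplicative (AddAut (geomTorsion W p)) ≃* GL (Fin 2) (ZMod p))
  (k : Subalgebra (ZMod p) (Matrix (Fin 2) (Fin 2) (ZMod p))) (e₀ : geomTorsion W p ≃+ (Fin 2 → ZMod p))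
  (he₀ : ∀ (g : Multiplicative (AddAut (geomTorsion W p))) (x : geomTorsion W p),
    e₀ (Multiplicative.toAdd g x) = ((Φ g : GL (Fin 2) (ZMod p)) : Matrix (Fin 2) (Fin 2) (ZMod p)) *ᵥ e₀ x)

include he₀ in
/-- The Galois action on coordinates: `e₀ (σ • m) = Φ(ρ̄ σ) *ᵥ e₀ m`. [folklore] -/
theorem coords_smul (σ : Field.absoluteGaloisGroup F) (m : geomTorsion W p) :
    e₀ (σ • m) = ((Φ (galoisRepTorsion W p σ) : GL (Fin 2) (ZMod p)) : Matrix (Fin 2) (Fin 2) (ZMod p)) *ᵥ e₀ m := by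
  rw [← galoisRepTorsion_apply, he₀]

include he₀ in
/-- ★ **Commutant rigidity on `W[p]`**: an additive endomorphism `û` of `W[p]` commuting with the action of ONE `σ₀` whose `ρ̄(σ₀) ∈ kˣ` is non-scalar is
multiplication by an element of `k` in the frame `e₀`. [cite: Serre1972, §2.2] -/
theorem exists_mem_forall_eq_mulVec_of_smul_comm {σ₀ : Field.absoluteGaloisGroup F} (hσ₀ : Φ (galoisRepTorsion W p σ₀) ∈ unitGroup k)
    (hσ₀s : ∀ c : ZMod p, ((Φ (galoisRepTorsion W p σ₀) : GL (Fin 2) (ZMod p)) : Matrix (Fin 2) (Fin 2) (ZMod p)) ≠ c • 1)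
    (û : geomTorsion W p →+ geomTorsion W p) (hcomm : ∀ m : geomTorsion W p, û (σ₀ • m) = σ₀ • û m) :
    ∃ z ∈ k, ∀ m : geomTorsion W p, e₀ (û m) = z *ᵥ e₀ m :=
  exists_mem_forall_eq_mulVec_of_comm k e₀ hσ₀ hσ₀s (fun m ↦ σ₀ • m) (coords_smul W Φ e₀ he₀ σ₀) û hcomm

include he₀ in
/-- ★ **Local ⟹ global equivariance on `W[p]`**: such a `û` commutes with the action of EVERY `σ` with `ρ̄(σ) ∈ kˣ` (in the glue: all of `Γ_K`, by `hKU`).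
[cite: Serre1972, §2.2] -/
theorem smul_comm_of_smul_comm (hk : IsField k) {σ₀ : Field.absoluteGaloisGroup F} (hσ₀ : Φ (galoisRepTorsion W p σ₀) ∈ unitGroup k)
    (hσ₀s : ∀ c : ZMod p, ((Φ (galoisRepTorsion W p σ₀) : GL (Fin 2) (ZMod p)) : Matrix (Fin 2) (Fin 2) (ZMod p)) ≠ c • 1)
    (û : geomTorsion W p →+ geomTorsion W p) (hcomm : ∀ m : geomTorsion W p, û (σ₀ • m) = σ₀ • û m)
    {σ : Field.absoluteGaloisGroup F} (hσ : Φ (galoisRepTorsion W p σ) ∈ unitGroup k) (m : geomTorsion W p) :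
    û (σ • m) = σ • û m :=
  comm_of_comm_of_mem_unitGroup k e₀ hk hσ₀ hσ₀s (fun m ↦ σ₀ • m) (coords_smul W Φ e₀ he₀ σ₀) û hcomm hσ (fun m ↦ σ • m)
    (coords_smul W Φ e₀ he₀ σ) m

include he₀ in
/-- ★★ **A unital ring action on `W[p]` commuting with one non-scalar `ρ̄(σ₀) ∈ kˣ` and having one non-scalar member realises every `z ∈ k`** — with the LEAD's
`exists_kStructure_endomorphism_coords` (`e₀ (u m) = y *ᵥ e₀ m`, `y ∈ k`): `u = u r` for some `r`. [cite: Serre1972, §2.1–2.2] -/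
theorem forall_mem_exists_torsionAction_eq (h2 : Module.finrank (ZMod p) k = 2) {σ₀ : Field.absoluteGaloisGroup F}
    (hσ₀ : Φ (galoisRepTorsion W p σ₀) ∈ unitGroup k)
    (hσ₀s : ∀ c : ZMod p, ((Φ (galoisRepTorsion W p σ₀) : GL (Fin 2) (ZMod p)) : Matrix (Fin 2) (Fin 2) (ZMod p)) ≠ c • 1)
    {R : Type*} [Semiring R] (u : R → (geomTorsion W p →+ geomTorsion W p))
    (hadd : ∀ (a b : R) (m : geomTorsion W p), u (a + b) m = u a m + u b m)
    (hmul : ∀ (a b : R) (m : geomTorsion W p), u (a * b) m = u a (u b m)) (hone : ∀ m : geomTorsion W p, u 1 m = m)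
    (hcomm : ∀ (r : R) (m : geomTorsion W p), u r (σ₀ • m) = σ₀ • u r m)
    {r₀ : R} (hr₀ : ∀ c : ZMod p, ∃ m : geomTorsion W p, e₀ (u r₀ m) ≠ c • e₀ m)
    {z : Matrix (Fin 2) (Fin 2) (ZMod p)} (hz : z ∈ k) :
    ∃ r : R, ∀ m : geomTorsion W p, e₀ (u r m) = z *ᵥ e₀ m :=
  forall_mem_exists_forall_eq_mulVec k e₀ h2 hσ₀ hσ₀s (fun m ↦ σ₀ • m) (coords_smul W Φ e₀ he₀ σ₀) u hadd hmul hone hcomm hr₀ z hz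

end Curve

end Summit.BirchSwinnertonDyer.BirchSwinnertonDyer.Theorems.SmallImageCharSignedSelmer

end
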